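import Summits.CriticalPhenomena.Ising3D.TaylorTableEvenHeadFast
import HarnessLib

/-!
# The TABLE layer of a derivative certificate, XV: FAST even head cells SPLIT into claimed partial sums (one kernel declaration per part)
(cell `pub-ising3x`, seat boot-1 gen 7; gate (g2) cost repair, part 2)

HONEST FRAMING: lottery ticket; floor = tightest certified 3D Ising CFT bounds; no exact-solution
claim without a proof. Island framing: certified exclusion region at stated derivative order and
assumptions; not a determination of the 3D Ising critical exponents beyond that.

MEASURED (HOME/pub-ising3x-boot-1/COST-HEAD-KERNEL.md §4): `evenHeadTMOK` costs ≈ 1.5 kernel-seconds per head term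
and component and a single `decide +kernel` is linear only below ≈ 60–90 s of work — a 40-term cell is 70 s, a 185-term
cell does not finish in 1 750 s. So a real cell (|F| up to ≈ 400 at E₀ = 40) must be checked in PARTS, each its own
declaration: the certificate carries, per cell, a list of `HeadPart`s — a term range `[t0, t0 + count)` of the head list
and CLAIMED interval polynomials `PX, PY, PZ` for the partial head polynomials of that range — and the kernel checks
(i) per part: the computed partial polynomials (`headPolyTM` on the slice) are contained in the claims
(`evenHeadPartOK`, one `decide` each, ≤ 40 terms), (ii) once: the ranges tile the head list and the SUMMED claims
pass `posOn` / `posOnD` (`evenHeadPartsFinalOK`). **`evenHead_nonneg_of_parts`** concludes exactly what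
`evenHead_nonneg_of_tmOK` concludes. Soundness: containment is monotone (`pmem_of_subsetI`), sums by `pmem_addI`,
and the head sum over `F` splits over the tiling (`List.take_append_drop`). The claims are untrusted producer data.
Pattern = K34v2's "level ranges" (PointKernelParts) and recog-1 g11's literal-row pieces. No new mathematics. [folklore]
-/

namespace Summit.CriticalPhenomena.Ising3D

open Finset Set
open Literature.Analysis.ValidatedNumerics Literature.Analysis.ValidatedNumerics.PolyMP
open Literature.Analysis.ValidatedNumerics.NumericsMP (MI)
open Literature.MathematicalPhysics.QuantumFieldTheory.ConformalBootstrap3D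

/-- One claimed part of a head cell: the term range `[t0, t0 + count)` of the head list and the claimed interval
polynomials of the three partial head polynomials on it. [folklore] -/
structure HeadPart where
  /-- first term index -/
  t0 : ℕ
  /-- number of terms -/
  count : ℕ
  /-- claimed partial `X̃` polynomial -/
  PX : IPoly
  /-- claimed partial `Ỹ` polynomial -/
  PY : IPoly
  /-- claimed partial `Z̃` polynomial -/
  PZ : IPoly

/-- The slice of the head list a part refers to. [folklore] -/
def HeadPart.slice (p : HeadPart) (F : List (ℕ × ℕ)) : List (ℕ × ℕ) := (F.drop p.t0).take p.count

/-- **Per-part check** (one kernel declaration each): the computed partial head polynomials on the slice are contained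
in the claims. [folklore] -/
def evenHeadPartOK (R : EvenRows) (C : EvenCellTM) (p : HeadPart) : Bool :=
  let tms := HRTM.rows R.S C.ctr C.ℓ C.e C.D C.nF
  subsetI (headPolyTM R.S R.RX tms C.nF C.ℓ C.ctr (p.slice C.F)) p.PX &&
    subsetI (headPolyTM R.S R.RY tms C.nF C.ℓ C.ctr (p.slice C.F)) p.PY &&
    subsetI (headPolyTM R.S R.RZ tms C.nF C.ℓ C.ctr (p.slice C.F)) p.PZ

/-- The ranges tile `[0, n)` consecutively: part `i` starts where part `i-1` ends, the last ends at `n`. [folklore] -/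
def tilesOK : ℕ → List HeadPart → ℕ → Bool
  | pos, [], n => decide (pos = n)
  | pos, p :: ps, n => decide (p.t0 = pos) && tilesOK (pos + p.count) ps n

/-- Summed claims. [folklore] -/
def sumPX : List HeadPart → IPoly
  | [] => []
  | p :: ps => addI p.PX (sumPX ps)
/-- Summed claims. [folklore] -/
def sumPY : List HeadPart → IPoly
  | [] => []
  | p :: ps => addI p.PY (sumPY ps)
/-- Summed claims. [folklore] -/
def sumPZ : List HeadPart → IPoly
  | [] => []
  | p :: ps => addI p.PZ (sumPZ ps)

/-- **Final check** (one declaration): side conditions of `evenHeadTMOK`, the tiling, and the sign tests on the SUMMED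
claims. [folklore] -/
def evenHeadPartsFinalOK (R : EvenRows) (dP : ℕ) (C : EvenCellTM) (ps : List HeadPart) : Bool :=
  decide (0 < R.S) && decide (1 ≤ C.D) && HRTM.pivOK C.ctr C.ℓ C.e C.nF &&
    (C.F.all fun q => decide (q.2 < R.J)) && tilesOK 0 ps C.F.length &&
    posOn R.S dP (sumPX ps) (-C.hw) C.hw && posOn R.S dP (sumPY ps) (-C.hw) C.hw &&
    posOnD R.S (sumPX ps) (sumPY ps) (sumPZ ps) dP (-C.hw) C.hw

/-! ### Soundness -/

/-- The head polynomial's value is additive over a split of the head list. [folklore] -/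
theorem evalR_headPolyTMR_append (row : ℕ → List ℝ) (asq : ℕ × ℕ → List ℝ) (ℓ : ℕ) (ctr : ℚ) (ρ : ℝ)
    (F₁ F₂ : List (ℕ × ℕ)) :
    evalR (headPolyTMR row asq ℓ ctr (F₁ ++ F₂)) ρ =
      evalR (headPolyTMR row asq ℓ ctr F₁) ρ + evalR (headPolyTMR row asq ℓ ctr F₂) ρ := by
  simp only [evalR_headPolyTMR, List.map_append, List.sum_append]

/-- **The parts lemma**: if the parts tile `[pos, |F|)` and every part's claim contains its computed partial polynomial,
there are real coefficient lists in the summed claims whose values are the head polynomials of `F.drop pos`. [folklore] -/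
theorem parts_pmem {S : ℕ} (hS : 0 < S) {rowX rowY rowZ : ℕ → List ℝ} {RX RY RZ : List IPoly}
    {asq : ℕ × ℕ → List ℝ} {tms : List (List IPoly)} {nF ℓ : ℕ} {ctr : ℚ} {F : List (ℕ × ℕ)}
    (hrowX : ∀ q ∈ F, PMem S (rowX q.2) (RX.getD q.2 [])) (hrowY : ∀ q ∈ F, PMem S (rowY q.2) (RY.getD q.2 []))
    (hrowZ : ∀ q ∈ F, PMem S (rowZ q.2) (RZ.getD q.2 []))
    (hasq : ∀ q ∈ F, PMem S (asq q) (HRTM.rowEntry tms nF q.1 q.2)) (ρ : ℝ) :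
    ∀ (ps : List HeadPart) (pos : ℕ), tilesOK pos ps F.length = true →
      (∀ p ∈ ps, (subsetI (headPolyTM S RX tms nF ℓ ctr (p.slice F)) p.PX &&
        subsetI (headPolyTM S RY tms nF ℓ ctr (p.slice F)) p.PY &&
        subsetI (headPolyTM S RZ tms nF ℓ ctr (p.slice F)) p.PZ) = true) →
      ∃ ax ay az : List ℝ, PMem S ax (sumPX ps) ∧ PMem S ay (sumPY ps) ∧ PMem S az (sumPZ ps) ∧
        evalR ax ρ = evalR (headPolyTMR rowX asq ℓ ctr (F.drop pos)) ρ ∧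
        evalR ay ρ = evalR (headPolyTMR rowY asq ℓ ctr (F.drop pos)) ρ ∧
        evalR az ρ = evalR (headPolyTMR rowZ asq ℓ ctr (F.drop pos)) ρ
  | [], pos, htile, _ => by
      simp only [tilesOK, decide_eq_true_eq] at htile
      subst htile
      refine ⟨[], [], [], pmem_nil S, pmem_nil S, pmem_nil S, ?_, ?_, ?_⟩ <;>
        simp [headPolyTMR, List.drop_length]
  | p :: ps, pos, htile, hparts => by
      simp only [tilesOK, Bool.and_eq_true, decide_eq_true_eq] at htile
      obtain ⟨ht0, htile'⟩ := htile
      have hp := hparts p (by simp)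
      simp only [Bool.and_eq_true] at hp
      obtain ⟨⟨hpx, hpy⟩, hpz⟩ := hp
      obtain ⟨ax', ay', az', hax', hay', haz', ex', ey', ez'⟩ :=
        parts_pmem hS hrowX hrowY hrowZ hasq ρ ps (pos + p.count) htile' (fun p' hp' => hparts p' (List.mem_cons_of_mem _ hp'))
      -- members of the slice are members of F
      have hsl : ∀ q ∈ p.slice F, q ∈ F := fun q hq =>
        List.mem_of_mem_drop (List.mem_of_mem_take hq)
      have hPX := pmem_of_subsetI (pmem_headPolyTM hS (ℓ := ℓ) (ctr := ctr) (p.slice F)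
        (fun q hq => hrowX q (hsl q hq)) (fun q hq => hasq q (hsl q hq))) hpx
      have hPY := pmem_of_subsetI (pmem_headPolyTM hS (ℓ := ℓ) (ctr := ctr) (p.slice F)
        (fun q hq => hrowY q (hsl q hq)) (fun q hq => hasq q (hsl q hq))) hpy
      have hPZ := pmem_of_subsetI (pmem_headPolyTM hS (ℓ := ℓ) (ctr := ctr) (p.slice F)
        (fun q hq => hrowZ q (hsl q hq)) (fun q hq => hasq q (hsl q hq))) hpz
      -- the split of `F.drop pos`
      have hsplit : F.drop pos = p.slice F ++ F.drop (pos + p.count) := by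
        rw [HeadPart.slice, ht0, ← List.drop_drop, List.take_append_drop]
      refine ⟨addR _ ax', addR _ ay', addR _ az', pmem_addI hPX hax', pmem_addI hPY hay', pmem_addI hPZ haz',
        ?_, ?_, ?_⟩
      · rw [evalR_addR, ex', hsplit, evalR_headPolyTMR_append]
      · rw [evalR_addR, ey', hsplit, evalR_headPolyTMR_append]
      · rw [evalR_addR, ez', hsplit, evalR_headPolyTMR_append]

/-- **TABLE THEOREM, even head cell, FAST form, SPLIT INTO PARTS.** Every part's containment check passes (one
declaration each) and the final check on the summed claims passes ⇒ the head form is PSD on box × cell (statement of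
`evenHead_nonneg_of_tmOK`). [cite: KosPolandSimmonsduffin2014, §3.3 eq. (3.16)] -/
theorem evenHead_nonneg_of_parts (c : Fin 5 → ℕ × ℕ → ℚ) {L : List (ℕ × ℕ)} (hL : L.Nodup)
    {C : EvenCellTM} (hF : C.F.Nodup) (hFj : ∀ q ∈ C.F, q.2 ≤ C.ℓ + q.1) (hℓlo : (C.ℓ : ℚ) ≤ C.lo)
    {σlo σhi εlo εhi : ℚ} {R : EvenRows} (hR : R.Valid c L σlo σhi εlo εhi)
    {dP : ℕ} {ps : List HeadPart} (hparts : ∀ p ∈ ps, evenHeadPartOK R C p = true)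
    (h : evenHeadPartsFinalOK R dP C ps = true) :
    ∀ p ∈ Icc (σlo : ℝ) σhi ×ˢ Icc (εlo : ℝ) εhi, ∀ Δ : ℝ, (C.lo : ℝ) ≤ Δ → Δ ≤ C.hi → ∀ a b : ℝ,
      0 ≤ ∑ q ∈ C.F.toFinset, hrCoeff Δ C.ℓ q.1 q.2 / legendreLam C.ℓ *
        (taylorCrossing (1 / 2) (1 / 2) L.toFinset (fun i ab => (c i ab : ℝ))).evenForm p.1 p.2
          (zMono (Δ + (q.1 : ℝ)) q.2) a b := by
  intro p hp Δ hlo hhi a b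
  obtain ⟨hσ, hε⟩ := hp
  simp only [evenHeadPartsFinalOK, Bool.and_eq_true, decide_eq_true_eq, List.all_eq_true] at h
  obtain ⟨⟨⟨⟨⟨⟨⟨hS, hD⟩, hpiv⟩, hJ⟩, htile⟩, hX⟩, hY⟩, hDisc⟩ := h
  -- the local variable (verbatim from `evenHead_nonneg_of_tmOK`)
  set ρ : ℝ := Δ - (C.ctr : ℝ) with hρdef
  have hΔ : Δ = (C.ctr : ℝ) + ρ := by rw [hρdef]; ring
  have hlo' : ((C.lo : ℚ) : ℝ) = (C.ctr : ℝ) - ((C.hw : ℚ) : ℝ) := by rw [EvenCellTM.lo]; push_cast; ring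
  have hhi' : ((C.hi : ℚ) : ℝ) = (C.ctr : ℝ) + ((C.hw : ℚ) : ℝ) := by rw [EvenCellTM.hi]; push_cast; ring
  have hρ1 : ((-C.hw : ℚ) : ℝ) ≤ ρ := by push_cast; linarith
  have hρ2 : ρ ≤ ((C.hw : ℚ) : ℝ) := by linarith
  have hρabs : |ρ| ≤ ((1 : ℚ) / 2 ^ C.e : ℚ) := by
    have : ((C.hw : ℚ) : ℝ) = (((1 : ℚ) / 2 ^ C.e : ℚ) : ℝ) := by rw [EvenCellTM.hw]
    rw [abs_le, ← this]; exact ⟨by linarith, hρ2⟩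
  have hhw : -C.hw ≤ C.hw := by
    have : (0 : ℚ) ≤ C.hw := by rw [EvenCellTM.hw]; positivity
    linarith
  have hℓΔ : (C.ℓ : ℝ) ≤ Δ := by
    have : ((C.ℓ : ℚ) : ℝ) ≤ ((C.lo : ℚ) : ℝ) := by exact_mod_cast hℓlo
    push_cast at this
    linarith
  -- Taylor models of the coefficients at this ρ
  have htm : ∀ q ∈ C.F, ∃ as : List ℝ, PMem R.S as (HRTM.rowEntry (HRTM.rows R.S C.ctr C.ℓ C.e C.D C.nF) C.nF q.1 q.2) ∧
      hrCoeff ((C.ctr : ℝ) + ρ) C.ℓ q.1 q.2 = evalR as ρ :=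
    fun q hq => HRTM.tmem_rows hD hpiv (C.le_nF q hq) q.2 ρ hρabs
  classical
  let asq : ℕ × ℕ → List ℝ := fun q => if hq : q ∈ C.F then Classical.choose (htm q hq) else []
  have hasq_mem : ∀ q ∈ C.F, PMem R.S (asq q) (HRTM.rowEntry (HRTM.rows R.S C.ctr C.ℓ C.e C.D C.nF) C.nF q.1 q.2) := by
    intro q hq; simp only [asq, dif_pos hq]; exact (Classical.choose_spec (htm q hq)).1
  have hasq_val : ∀ q ∈ C.F, hrCoeff ((C.ctr : ℝ) + ρ) C.ℓ q.1 q.2 = evalR (asq q) ρ := by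
    intro q hq; simp only [asq, dif_pos hq]; exact (Classical.choose_spec (htm q hq)).2
  -- rows
  have hrowX : ∀ q ∈ C.F, PMem R.S (qRow (c 0) (-1) p.1 L q.2) (R.RX.getD q.2 []) :=
    fun q hq => (hR.2 p.1 hσ p.2 hε q.2 (hJ q hq)).1
  have hrowY : ∀ q ∈ C.F, PMem R.S (qRow (c 1) (-1) p.2 L q.2) (R.RY.getD q.2 []) :=
    fun q hq => (hR.2 p.1 hσ p.2 hε q.2 (hJ q hq)).2.1
  have hrowZ : ∀ q ∈ C.F, PMem R.S (EvenRows.rowZ c L ((p.1 + p.2) / 2) q.2) (R.RZ.getD q.2 []) :=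
    fun q hq => (hR.2 p.1 hσ p.2 hε q.2 (hJ q hq)).2.2
  -- the parts
  have hparts' : ∀ p' ∈ ps, (subsetI (headPolyTM R.S R.RX (HRTM.rows R.S C.ctr C.ℓ C.e C.D C.nF) C.nF C.ℓ C.ctr (p'.slice C.F)) p'.PX &&
      subsetI (headPolyTM R.S R.RY (HRTM.rows R.S C.ctr C.ℓ C.e C.D C.nF) C.nF C.ℓ C.ctr (p'.slice C.F)) p'.PY &&
      subsetI (headPolyTM R.S R.RZ (HRTM.rows R.S C.ctr C.ℓ C.e C.D C.nF) C.nF C.ℓ C.ctr (p'.slice C.F)) p'.PZ) = true :=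
    fun p' hp' => by simpa [evenHeadPartOK] using hparts p' hp'
  obtain ⟨ax, ay, az, hPX, hPY, hPZ, eX', eY', eZ'⟩ :=
    parts_pmem hS (ℓ := C.ℓ) (ctr := C.ctr) hrowX hrowY hrowZ hasq_mem ρ ps 0 htile hparts'
  rw [List.drop_zero] at eX' eY' eZ'
  -- the three real values
  have eX := evenHeadX_eq_evalR_TM c hL 0 (-1) C.ℓ C.ctr C.F p.1 ρ hasq_val
  have eY := evenHeadX_eq_evalR_TM c hL 1 (-1) C.ℓ C.ctr C.F p.2 ρ hasq_val
  have eZ := evenHeadZ_eq_evalR_TM c hL C.ℓ C.ctr C.F ((p.1 + p.2) / 2) ρ hasq_val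
  push_cast at eX eY
  have h1 := posOn_sound hS hX hhw hPX hρ1 hρ2
  have h2 := posOn_sound hS hY hhw hPY hρ1 hρ2
  have h3 := posOnD_sound hS hPX hPY hPZ hDisc hhw hρ1 hρ2
  rw [eX', ← eX] at h1 h3
  rw [eY', ← eY] at h2 h3
  rw [eZ', ← eZ] at h3
  rw [hΔ]
  refine evenHead_nonneg_of_reduced L.toFinset (fun i ab => (c i ab : ℝ)) C.ℓ C.F hF hFj (hΔ ▸ hℓΔ) p.1 p.2
    h1.le h2.le ?_ a b
  nlinarith [h3]

end Summit.CriticalPhenomena.Ising3D
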